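import Summits.QuantumAdvantage.QuantumAdvantage.Theorems.InnerDegreeLawsG

set_option linter.dupNamespace false

/-!
# InnerDegreeLawsH (lens 4, g27; part H = LAND-PACKAGE-5) — the saturated regime of PatternRank under its symmetry group: affine labels and any non-degenerate change of pairing are absorbed by reindexing (rank ≥ p^r persists), and the affine-saturated rectangle kill = the (c0) criterion «two non-degenerately paired affine flats in the subset-sum sets of the cross block»

Blocker `X = AbsorptionDial.NoPerfectPolyOdd` (item 28487); decomp-qadv lens 4 (minimal-counterexample / extremal reduction), g27.  The NODE record
(rung `QuadFormNoPerfectOdd`, residual `QuadLiftOdd`, sub-rung `OneQuadNoPerfectOdd`, floor `linFormFloor`, `x_iff_pieces`) lives in the cell file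
`g27/InnerDegreeDial.lean` and is NOT landed (Prop-definition node pieces); the tree parts are Prop-definition-free and state only unconditional LAWS.
Parts A–G are LANDED (p825604/p825613/p825616/p825666/p826280/p826399/p826805; LAW C/Q/E/S/C⁺, first-moment subcubes, deletion identity, normal form,
LAW R, MOD_p / affine rectangle kills, saturated regime); part H is the LAND-PACKAGE-5 delta (imports part G only).  Kernel-checked content:

* §15 **the saturated kill under its symmetry group** (NODE7): `rank ≥ p^r` persists for `[f(⟨v, N w⟩ + ⟨v,a⟩ + ⟨b,w⟩)]` — affine labels
  `a, b` (translation of the index spaces) and any right-invertible pairing matrix `N` (`rank_satPat_affine_ge`, `rank_satPat_bilin_ge`);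
  game corollary `loss_of_affineSaturatedRectangle` = the (c0) criterion «two non-degenerately paired affine `(r+1)`-flats inside the
  subset-sum sets of the two halves of the cross block defeat every non-constant table».
-/

open Finset
open Summit.QuantumAdvantage.AdviceFreeQNC0

namespace Summit.QuantumAdvantage.QuantumAdvantage.Theorems.InnerDegreeDial

/-! ### §15 the saturated kill under its SYMMETRY GROUP (NODE7 §3 (c0)(viii)): affine labels and change of pairing

The bound of §14 is invariant under translations of both index spaces and under any non-degenerate change of the bilinear pairing:
`[f(⟨v, N w⟩ + ⟨v,a⟩ + ⟨b,w⟩)]_{v,w ∈ 𝔽_p^{r+1}}` has rank `≥ p^r` for every non-constant `f`, every `a, b` and every right-invertible `N`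
(`rank_satPat_affine_ge`, `rank_satPat_bilin_ge`: the saturated pattern of a translate of `f` is a two-sided reindexing, so
`Matrix.rank_submatrix_le` transfers §14).  Game corollary `loss_of_affineSaturatedRectangle`: the (c0) criterion «two affine
`(r+1)`-flats inside the subset-sum sets of the two halves of the cross block, non-degenerately paired» defeats every non-constant table. -/

section SaturatedSymm

variable {K : Type*} [Field K] [CharP K 2]
variable {p : ℕ} [Fact p.Prime]

/-- translation invariance: affine labels `⟨v,a⟩ + ⟨b,w⟩` are absorbed by the reindexing `v ↦ v + b`, `w ↦ w + a`, so the affinely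
labelled saturated pattern `[f(⟨v,w⟩ + ⟨v,a⟩ + ⟨b,w⟩)]_{v,w ∈ 𝔽_p^{r+1}}` still has rank `≥ p^r` for every non-constant `f`. -/
theorem rank_satPat_affine_ge (hp5 : 5 ≤ p) {ω : K} (hω : IsPrimitiveRoot ω p) (f : ZMod p → K) {a' b' : ZMod p}
    (hab : f a' ≠ f b') (r : ℕ) (a b : Fin (r + 1) → ZMod p) :
    p ^ r ≤ (Matrix.of fun v w : Fin (r + 1) → ZMod p => f (v ⬝ᵥ w + v ⬝ᵥ a + b ⬝ᵥ w)).rank := by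
  classical
  have hsub : (Matrix.of fun v w : Fin (r + 1) → ZMod p => f (v ⬝ᵥ w + v ⬝ᵥ a + b ⬝ᵥ w)).submatrix
      (fun v => v - b) (fun w => w - a) = satPat (fun t => f (t - b ⬝ᵥ a)) (r + 1) := by
    ext v w
    rw [Matrix.submatrix_apply, Matrix.of_apply, satPat, Matrix.of_apply]
    congr 1
    simp only [sub_dotProduct, dotProduct_sub]
    ring
  have hg : (fun t => f (t - b ⬝ᵥ a)) (a' + b ⬝ᵥ a) ≠ (fun t => f (t - b ⬝ᵥ a)) (b' + b ⬝ᵥ a) := by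
    show f (a' + b ⬝ᵥ a - b ⬝ᵥ a) ≠ f (b' + b ⬝ᵥ a - b ⬝ᵥ a)
    rw [add_sub_cancel_right, add_sub_cancel_right]
    exact hab
  have h1 := rank_satPat_ge hp5 hω (fun t => f (t - b ⬝ᵥ a)) hg r
  rw [← hsub] at h1
  exact h1.trans (Matrix.rank_submatrix_le _ _ _)

/-- change of pairing: if `N` has a right inverse then the pattern `[f(⟨v, N w⟩ + ⟨v,a⟩ + ⟨b,w⟩)]` contains, as the column-reindexing
`w ↦ N′ w`, the affinely labelled saturated pattern, so its rank is still `≥ p^r` — the saturated bound is invariant under the whole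
symmetry group (translations of both index spaces and any non-degenerate change of the bilinear pairing). -/
theorem rank_satPat_bilin_ge (hp5 : 5 ≤ p) {ω : K} (hω : IsPrimitiveRoot ω p) (f : ZMod p → K) {a' b' : ZMod p}
    (hab : f a' ≠ f b') (r : ℕ) (a b : Fin (r + 1) → ZMod p) (N N' : Matrix (Fin (r + 1)) (Fin (r + 1)) (ZMod p))
    (hN : N * N' = 1) :
    p ^ r ≤ (Matrix.of fun v w : Fin (r + 1) → ZMod p => f (v ⬝ᵥ (N.mulVec w) + v ⬝ᵥ a + b ⬝ᵥ w)).rank := by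
  classical
  have hsub : (Matrix.of fun v w : Fin (r + 1) → ZMod p => f (v ⬝ᵥ (N.mulVec w) + v ⬝ᵥ a + b ⬝ᵥ w)).submatrix
      id (fun w => N'.mulVec w)
      = Matrix.of fun v w : Fin (r + 1) → ZMod p => f (v ⬝ᵥ w + v ⬝ᵥ a + (Matrix.vecMul b N') ⬝ᵥ w) := by
    ext v w
    rw [Matrix.submatrix_apply, Matrix.of_apply, Matrix.of_apply, id, Matrix.mulVec_mulVec, hN, Matrix.one_mulVec,
      Matrix.dotProduct_mulVec]
  have h1 := rank_satPat_affine_ge hp5 hω f hab r a (Matrix.vecMul b N')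
  rw [← hsub] at h1
  exact h1.trans (Matrix.rank_submatrix_le _ _ _)

variable {n : ℕ}

/-- **THE SATURATED RECTANGLE KILL UNDER ITS SYMMETRY GROUP.**  As `loss_of_saturatedRectangle`, but `g₀` may fire as
`G₀(⟨v, N w⟩ + ⟨v,a⟩ + ⟨b,w⟩ + e)` for any right-invertible pairing matrix `N` and any affine labels `a, b, e`: the linear parts of the
register's quadratic form that factor through the rank factorisation of the cross block, and the choice of bases on the two sides, are
absorbed.  This is the (c0) criterion of NODE-g27 §3 (c0)(viii): two affine `(r+1)`-flats inside the subset-sum sets of the two halves of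
the cross block, non-degenerately paired, with `p^r > (n+1)·2p^k + 1`, defeat every non-constant table. -/
theorem loss_of_affineSaturatedRectangle (hp5 : 5 ≤ p) {k r : ℕ} (c : ℕ)
    (y : Fin (n + 1) → (Fin n → Bool) → Bool) (g₀ : Fin (n + 1))
    (lam : Fin (n + 1) → Fin k → Fin n → ZMod p) (F : Fin (n + 1) → (Fin k → ZMod p) → Bool)
    (hF : ∀ g, g ≠ g₀ → ∀ u, y g u = F g (fun j => ∑ i, if u i = true then lam g j i else 0))
    (X Y : (Fin (r + 1) → ZMod p) → Fin n → Bool) (hd : ∀ v w l, ¬ (X v l = true ∧ Y w l = true))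
    (G₀ : ZMod p → Bool) (e : ZMod p) {b₁ b₂ : ZMod p} (hG : G₀ b₁ ≠ G₀ b₂) (a b : Fin (r + 1) → ZMod p)
    (N N' : Matrix (Fin (r + 1)) (Fin (r + 1)) (ZMod p)) (hN : N * N' = 1)
    (hpat : ∀ v w, y g₀ (bor (X v) (Y w)) = G₀ (v ⬝ᵥ (N.mulVec w) + v ⬝ᵥ a + b ⬝ᵥ w + e))
    (hlive : ∀ v w, liveCut c (bor (X v) (Y w)) g₀ = true)
    (ht : (n + 1) * (p ^ k * 2) + 1 < p ^ r) :
    ∃ u, ringWinU c y u = false := by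
  classical
  obtain ⟨hK, ω, -, hω, -⟩ := Coset21.exists_charTwo_roots p hp5
  haveI := hK
  refine loss_of_rectRank hp5 c y g₀ lam F hF X Y hd (lt_of_lt_of_le ht ?_)
  have hrect : rect (Kp p) (fun u => y g₀ u && liveCut c u g₀) X Y
      = Matrix.of fun v w : Fin (r + 1) → ZMod p =>
          (fun t => if G₀ (t + e) = true then (1 : Kp p) else 0) (v ⬝ᵥ (N.mulVec w) + v ⬝ᵥ a + b ⬝ᵥ w) := by
    ext v w
    rw [rect, Matrix.of_apply, Matrix.of_apply]
    simp only [hpat v w, hlive v w, Bool.and_true]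
  rw [hrect]
  refine rank_satPat_bilin_ge hp5 hω (fun t => if G₀ (t + e) = true then (1 : Kp p) else 0)
    (a' := b₁ - e) (b' := b₂ - e) ?_ r a b N N' hN
  simp only [sub_add_cancel]
  intro h
  apply hG
  cases h1 : G₀ b₁ <;> cases h2 : G₀ b₂ <;> simp_all

end SaturatedSymm

end Summit.QuantumAdvantage.QuantumAdvantage.Theorems.InnerDegreeDial
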